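import Summits.ABC.IUTFork.Joshi.TestRealPinsEquivariance
import Summits.ABC.IUTFork.Thm311RealIsmDHMoverCensus
import Summits.ABC.IUTFork.Thm311RealIsmDHMoverCyclotomicBoundary
import Summits.ABC.IUTFork.Cor312VolumesRealDH
import HarnessLib

/-!
# Branch E TEST vs S — the (hρ)-EQUIVARIANT PIN AT THE HONEST REAL SETTING over the Dupuy–Hilado (Ind2), II:
# REFUTED at EVERY RAMIFIED place over a prime ≥ 5, and OUTRIGHT over the cyclotomic fields ℚ(ζ_p), p ≥ 5 (reader's companion)

Proof-only READER'S COMPANION (abc-iut cell, branch E, rung LADDER-ABC:A2.E; written by the typer-side RQ7 second reader abc-iut-E-t16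
gen 5 of abc-iut-E-t41's `Joshi/TestRealPinsEquivariance.lean` p445387 — hand item (a′) of abc-iut-E-cx-2; nothing of E-t41's, E-t43's,
w5-d216's or TEAM R's files is restated: every input BY NAME). **No side is taken** on [IUTchIII] Cor. 3.12 or on any author
(Mochizuki / Scholze–Stix / Joshi / Dupuy–Hilado); typed ≠ proved ≠ endorsed; located, not adjudicated. R14: `Joshi/Test*`. 0 `def`,
0 `instance`, no notation, no `Prop` fact; standard axioms.

WHAT p445387 PROVED: for a number field `F` with a TAMELY ramified place `v₀ ∣ p₀` (`p₀ > 2`, `2 ≤ e(v₀|p₀) ≤ p₀ − 2`), the full pin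
predicate `Cor312Vol.PinnedRegions` — including its (hρ)-half «`ρ` transforms under `⟨(Ind1) ∪ (Ind2)⟩`» — is UNINHABITED at E-t41/E-t43's
inhabited honest real setting `honestSetting` over the Dupuy–Hilado binders (`stripAutDH`, `ismDH`). The only place-dependent input of
that proof is a Dupuy–Hilado (Ind2)-element MOVING the unit ball `𝒪_{v₀}`, taken there from abc-iut-w5-d216's TAME mover criterion.

WHAT THIS FILE ADDS (kernel).
* `RamifiedPins.not_pinnedRegions_honestSetting_DH_of_five_le` — the same conclusion for EVERY ramified place `v₀ ∣ p₀` with `p₀ ≥ 5`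
  and `e(v₀|p₀) ≥ 2`, NO upper bound on `e` (wild ramification allowed): E-t41's steps §b–§f verbatim, the mover now taken from
  w5-d216's `p ≥ 5` CENSUS `Thm311.Real.exists_mem_ismDH_image_closedBall_one_ne_of_five_le` (`Thm311RealIsmDHMoverCensus`). Since
  `2 ≤ e ≤ p₀ − 2` forces `p₀ ≥ 5`, p445387's theorem is the special case (`…_of_tame'`, re-derived); `not_exists_…_of_five_le` packages it.
* `RamifiedPins.not_pinnedRegions_honestSetting_DH_cyclotomic` — a PLACE-FREE kernel witness of the field hypothesis: over every `F` with
  `IsCyclotomicExtension {p₀} ℚ F`, `p₀ ≥ 5` (e.g. `ℚ(ζ_5)`, `ℚ(ζ_7)`: `e = p₀ − 1 ≥ 2`, TEAM R's `CyclotomicBoundary`), `¬ PinnedRegions` for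
  ALL the remaining data — so the «(hρ)-pins ⟹ …» S-form theorems are VACUOUS at `honestSetting`/(DH) over these fields, while the
  region-pin (IndCoversQ) results p440805 / p441827 / p443555 are untouched (as p445387's honest-reading paragraph says; same repairs apply:
  restrict (hρ) to labels `j ∈ 𝔽_l^⋆`, read (Ind2) as isometries [IUTchII] Ex. 1.8 (iv), `univ` boxes at `j = 0`, hull-level regions).
[claim: Mochizuki2012, status: disputed] [cite: DupuyHilado2025, §4.9] [cite: NeukirchANT1999, Ch. II (5.7), (7.13)]
[cite: Washington1997, Lemma 1.4]
-/

noncomputable section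

open Metric Set Function NumberField IsDedekindDomain
open scoped Pointwise

namespace Summit.ABC.IUTFork.Joshi.RamifiedPins

open Summit.ABC.IUTFork.Joshi Summit.ABC.IUTFork
open Thm311 Thm311.Real Cor312 Cor312Vol Literature.IUT.LogThetaLattice Literature.IUT.LogVolume
open Literature.NumberTheory.NumberFields Literature.NumberTheory.GaloisRepresentations.Ultrametric

variable {F : Type} [Field F] [NumberField F] (X : PilotData F) {logv : PadicLogs F} (hlog : LogvAnalytic logv)
  (M : Type) [Field M] [NumberField M]
  (archPk : ∀ (j : (thetaIndex X).Label) (vQ : (thetaIndex X).VQ), Set ((logShellsDH X logv).Packet j vQ))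
  (archSub : ∀ (j : (thetaIndex X).Label) (v : (thetaIndex X).V), Set ((logShellsDH X logv).Packet j ((thetaIndex X).over v)))
  (Ψ : ℤ → ∀ v : (thetaIndex X).V, v ∈ (thetaIndex X).Vbad → Set ((logShellsDH X logv).StarPacket v))
  (act : ℤ → ∀ v : (thetaIndex X).V, v ∈ (thetaIndex X).Vbad →
    (logShellsDH X logv).StarPacket v → Module.End ℚ ((logShellsDH X logv).StarPacket v))
  (Mmod : ℤ → ∀ j : (thetaIndex X).LabelStar, Set ((logShellsDH X logv).GlobalPacket j.1))
  (region : ℤ → ∀ j : (thetaIndex X).LabelStar, FinDivisor M → ∀ vQ : (thetaIndex X).VQ, Set ((logShellsDH X logv).Packet j.1 vQ))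
  (col : ℤ → Column (logShellsDH X logv)) (n : ℤ) (p : ℕ)

/-- **`not_pinnedRegions_honestSetting_DH_of_five_le` — (a′)'s negative answer at EVERY RAMIFIED place over a prime `p₀ ≥ 5`**
(`2 ≤ e(v₀|p₀)`; NO upper bound on `e`, wild ramification allowed): for every column family, column, box prime, auxiliary data, `ρ`,
`qK`, `¬ PinnedRegions` at `honestSetting` over (`stripAutDH`, `ismDH logv`). PROOF = abc-iut-E-t41's (p445387 §2, steps §b–§f
verbatim: zero-label (Ind2)-generator from a mover of `𝒪_{v₀}`, trivial on star packets, yet moving `e⁻¹(𝒪_L)` at the packet `(0, p₀)`),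
with step §a's TAME mover (`2 < p₀`, `e ≤ p₀ − 2`, uniformiser; `Thm311RealIsmDHMoverCriterion`) REPLACED by abc-iut-w5-d216's `p ≥ 5`
CENSUS mover `Thm311.Real.exists_mem_ismDH_image_closedBall_one_ne_of_five_le` (`Thm311RealIsmDHMoverCensus`: over `p ≥ 5` no ramified
`F_v` has `𝒪_v = p^k·log_p(𝒪_v^×)`). Same HONEST READING as p445387 (what is refuted is the conjunction AS TYPED of (hρ) at all labels
incl. `j = 0`, DH's full (Ind2), `𝒪_L`-boxes at `j = 0`; repairs listed there). Located, not adjudicated. [claim: Mochizuki2012, status: disputed]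
[cite: DupuyHilado2025, §4.9] [cite: NeukirchANT1999, Ch. II (5.7), (7.13)] -/
theorem not_pinnedRegions_honestSetting_DH_of_five_le (pp : Nat.Primes) (hp5 : 5 ≤ (pp : ℕ)) (v₀ : HeightOneSpectrum (𝓞 F))
    (hv₀ : (thetaIndex X).over (.inr v₀) = .inr pp) (he2 : 2 ≤ v₀.asIdeal.ramificationIdx ℤ)
    (ρ : (∀ v : (thetaIndex X).V, v ∈ (thetaIndex X).Vbad → Set ((logShellsDH X logv).StarPacket v)) →
      ∀ (j : (thetaIndex X).Label) (vQ : (thetaIndex X).VQ), Set ((logShellsDH X logv).Packet j vQ))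
    (qK : ∀ v : (thetaIndex X).V, v ∈ (thetaIndex X).Vbad → Set ((logShellsDH X logv).StarPacket v)) :
    ¬ PinnedRegions (latticeSituationReal X hlog stripAutDH (ismDH logv) refl_mem_stripAutDH (refl_mem_ismDH logv) M archPk
        archSub Ψ act Mmod region col)
      (honestSetting X hlog stripAutDH (ismDH logv) refl_mem_stripAutDH (refl_mem_ismDH logv) M archPk archSub Ψ act Mmod
        region col n p) ρ qK := by
  classical
  intro hpin
  haveI hpF : Fact (pp : ℕ).Prime := ⟨pp.2⟩
  let L := logShellsDH X logv
  set x₀ : (thetaIndex X).Fibre (.inr pp) := ⟨.inr v₀, hv₀⟩ with hx₀def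
  set P := presAt X hlog pp
  have hlab : (((0 : (thetaIndex X).Label)) : ℕ) = 0 := Fin.val_zero _
  have hv : ((pp : ℕ) : 𝓞 F) ∈ v₀.asIdeal := natCast_mem_placeOf X pp x₀
  -- §a. a MOVER of the unit ball `𝒪_{v₀}` inside Dupuy–Hilado's (Ind2) from the p ≥ 5 CENSUS (w5-d216): no tameness, no bound on e
  obtain ⟨g, hg, hmov⟩ := exists_mem_ismDH_image_closedBall_one_ne_of_five_le (hlog pp) v₀ hv hp5 he2
  -- the moved unit ball, read on the carrier `Carrier (.inr v₀)` (= `K_{v₀}^{(1/n)}` as a type; `toR`/`ofR` are the identity)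
  let Bc : Set (Carrier (.inr v₀ : Thm311.Real.Place F)) := {z | ‖toR (pp : ℕ) v₀ hv z‖ ≤ 1}
  have hmem_Bc : ∀ z : Carrier (.inr v₀ : Thm311.Real.Place F), z ∈ Bc ↔ ‖toR (pp : ℕ) v₀ hv z‖ ≤ 1 := fun z => Iff.rfl
  have hgBc : ⇑g '' Bc ≠ Bc := by
    intro h
    apply hmov
    have hBc2 : (closedBall (0 : RescaledCompletion F (pp : ℕ) v₀ hv) 1) = Bc := by
      ext a
      rw [mem_closedBall_zero_iff]
      exact Iff.rfl
    rw [hBc2]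
    exact h
  -- §b. the ZERO-LABEL (Ind2)-generator: `g` at `v₀`, identity at the other places; identity at every nonzero label
  let gPl : ∀ y : Thm311.Real.Place F, Carrier y ≃ₗ[ℚ] Carrier y := fun y =>
    if h : y = .inr v₀ then (by subst h; exact g) else LinearEquiv.refl ℚ (Carrier y)
  have hgPl_v₀ : gPl (.inr v₀) = g := by
    show (if h : (Sum.inr v₀ : Thm311.Real.Place F) = .inr v₀ then _ else _) = g
    rw [dif_pos rfl]
  have hgPl_mem : ∀ y : Thm311.Real.Place F, gPl y ∈ ismDH logv y := by
    intro y
    by_cases hy : y = .inr v₀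
    · subst hy; rw [hgPl_v₀]; exact hg
    · show (if h : y = .inr v₀ then _ else _) ∈ _
      rw [dif_neg hy]; exact refl_mem_ismDH _ y
  let Φ₀ : L.PacketAut := fun j vQ =>
    if j = 0 then L.factorwise j vQ fun _ => L.summandwise vQ fun v => gPl v.1 else LinearEquiv.refl ℚ _
  have hΦ₀_zero : ∀ vQ, Φ₀ 0 vQ = L.factorwise 0 vQ fun _ => L.summandwise vQ fun v => gPl v.1 := fun vQ => if_pos rfl
  have hΦ₀_ne : ∀ (j : (thetaIndex X).Label) (vQ), j ≠ 0 → Φ₀ j vQ = LinearEquiv.refl ℚ _ := fun j vQ hj0 => if_neg hj0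
  have hΦ₀ : Φ₀ ∈ L.Ind2Family := by
    intro j vQ
    by_cases hj0 : j = 0
    · subst hj0
      exact ⟨fun _ v => gPl v.1, fun _ v => hgPl_mem v.1, hΦ₀_zero vQ⟩
    · rw [show Φ₀ j vQ = LinearEquiv.refl ℚ _ from hΦ₀_ne j vQ hj0]
      exact L.refl_mem_Ind2 j vQ
  have hΦ₀c : Φ₀ ∈ Subgroup.closure (L.Ind1Family ∪ L.Ind2Family) := Subgroup.subset_closure (Or.inr hΦ₀)
  -- it acts TRIVIALLY on every star packet (labels `j ≠ 0` only)
  have hid : ∀ (v : (thetaIndex X).V), v ∈ (thetaIndex X).Vbad → L.starAut Φ₀ v = LinearEquiv.refl ℚ _ := by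
    intro v _
    refine LinearEquiv.ext fun f => funext fun j => ?_
    show (Φ₀ j.1 ((thetaIndex X).over v)) (f j) = f j
    rw [hΦ₀_ne j.1 _ j.2]
    rfl
  -- §c. hence (p441977) it stabilises the `q`-image `e⁻¹(𝒪_L)` at the packet `(0, p₀)`
  have hEq := (honestSetting_images_stable_of_pinnedRegions X hlog stripAutDH (ismDH logv) refl_mem_stripAutDH
    (refl_mem_ismDH logv) M archPk archSub Ψ act Mmod region col n p hpin hΦ₀c hid 0 0 (.inr pp)).2
  rw [honestSetting_qRegion, preimage_factorMapDH_hullSet_one X hlog 0 pp] at hEq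
  -- §d. test vectors `⊗(z at v₀, 0 elsewhere)`; membership in `e⁻¹(Π (R_{v⃗})^∼)` reads `‖z‖ ≤ 1`
  let y1 : Carrier (.inr v₀ : Thm311.Real.Place F) → L.Packet1 (.inr pp) := fun z => Pi.single x₀ z
  have hy1_x₀ : ∀ z, y1 z x₀ = z := fun z => Pi.single_eq_same _ _
  have hy1_ne : ∀ z (v : (thetaIndex X).Fibre (.inr pp)), v ≠ x₀ → y1 z v = 0 := fun z v hv' => Pi.single_eq_of_ne hv' _
  let xz : Carrier (.inr v₀ : Thm311.Real.Place F) → L.Packet 0 (.inr pp) := fun z => L.tprod 0 (.inr pp) fun _ => y1 z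
  -- `φ_{v₀} = id`: the presentation coordinate of `z` IS `z`, with the rescaled norm
  have hφx₀ : ∀ z : Carrier (.inr v₀ : Thm311.Real.Place F), ‖P.φ x₀ z‖ = ‖toR (pp : ℕ) v₀ hv z‖ := fun z => rfl
  have hall : ∀ z, z ∈ Bc → ∀ v : (thetaIndex X).Fibre (.inr pp), ‖P.φ v (y1 z v)‖ ≤ 1 := by
    intro z hz v
    by_cases hv' : v = x₀
    · subst hv'
      rw [hy1_x₀, hφx₀]
      exact hz
    · rw [hy1_ne z v hv', map_zero, norm_zero]
      exact zero_le_one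
  have hmem_xz : ∀ z, xz z ∈ P.comparison 0 ⁻¹' (Set.pi univ fun ev =>
      (normalizedPacket pp.1 (P.kk ev) : Set (P.X ev))) ↔ z ∈ Bc := by
    intro z
    rw [hmem_Bc, Set.mem_preimage, Set.mem_univ_pi]
    constructor
    · intro h
      have h0 := h (fun _ => x₀)
      rw [show P.comparison 0 (xz z) (fun _ => x₀) = _ from P.comparison_tprod 0 (fun _ => y1 z) (fun _ => x₀),
        IsmDHMover.tprod_eq_iota_last _ hlab, SetLike.mem_coe,
        IsmDHMover.mem_normalizedPacket_iff_norm_dEquiv_le] at h0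
      obtain ⟨i⟩ := nonempty_dIdx pp.1 (P.kk fun _ : (thetaIndex X).Caps 0 => x₀)
      have h1 := h0 i
      rw [norm_dEquiv_iota, hy1_x₀, hφx₀] at h1
      exact h1
    · intro hz ev
      rw [show P.comparison 0 (xz z) ev = _ from P.comparison_tprod 0 (fun _ => y1 z) ev,
        IsmDHMover.tprod_eq_iota_last _ hlab, SetLike.mem_coe, IsmDHMover.mem_normalizedPacket_iff_norm_dEquiv_le]
      intro i
      rw [norm_dEquiv_iota]
      exact hall z hz (ev (Fin.last _))
  -- §e. the generator acts on the test vectors by `g` at `v₀`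
  have hΦxz : ∀ z, Φ₀ 0 (.inr pp) (xz z) = xz (g z) := by
    intro z
    rw [hΦ₀_zero]
    show L.factorwise 0 (.inr pp) (fun _ => L.summandwise (.inr pp) fun v => gPl v.1)
        (L.tprod 0 (.inr pp) fun _ => y1 z) = L.tprod 0 (.inr pp) fun _ => y1 (g z)
    rw [L.factorwise_summandwise_tprod]
    congr 1
    funext a v
    by_cases hv' : v = x₀
    · rw [hv', hy1_x₀, hy1_x₀]
      show gPl (.inr v₀) z = g z
      rw [hgPl_v₀]
    · rw [hy1_ne z _ hv', hy1_ne (g z) _ hv', map_zero]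
  -- §f. contradiction: `Φ₀` does not map `e⁻¹(Π (R)^∼)` onto itself
  have key : ∀ x, x ∈ _ ↔ Φ₀ 0 (.inr pp) x ∈ _ := fun x =>
    ((Φ₀ 0 (.inr pp)).injective.mem_set_image).symm.trans (Set.ext_iff.mp hEq (Φ₀ 0 (.inr pp) x))
  rcases IsmDHMover.exists_of_image_ne g.toEquiv hgBc with ⟨z, hz, hgz⟩ | ⟨z, hz, hgz⟩
  · have h1 : Φ₀ 0 (.inr pp) (xz z) ∈ _ := (key (xz z)).mp ((hmem_xz z).mpr hz)
    have h2 := (hΦxz z) ▸ h1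
    exact hgz ((hmem_xz (g z)).mp h2)
  · have h1 : xz (g z) ∈ _ := (hmem_xz (g z)).mpr hgz
    have h2 := (hΦxz z).symm ▸ h1
    exact hz ((hmem_xz z).mp ((key (xz z)).mpr h2))


/-- **E-t41's `not_pinnedRegions_honestSetting_DH` (p445387) RE-DERIVED as the special case** `2 ≤ e(v₀|p₀) ≤ p₀ − 2` of the
ramified form (the two bounds force `p₀ ≥ 5`). Same statement as the original; new proof route. [claim: Mochizuki2012, status: disputed] -/
theorem not_pinnedRegions_honestSetting_DH_of_tame' (pp : Nat.Primes) (hp2 : 2 < (pp : ℕ)) (v₀ : HeightOneSpectrum (𝓞 F))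
    (hv₀ : (thetaIndex X).over (.inr v₀) = .inr pp) (he2 : 2 ≤ v₀.asIdeal.ramificationIdx ℤ)
    (he : v₀.asIdeal.ramificationIdx ℤ ≤ (pp : ℕ) - 2)
    (ρ : (∀ v : (thetaIndex X).V, v ∈ (thetaIndex X).Vbad → Set ((logShellsDH X logv).StarPacket v)) →
      ∀ (j : (thetaIndex X).Label) (vQ : (thetaIndex X).VQ), Set ((logShellsDH X logv).Packet j vQ))
    (qK : ∀ v : (thetaIndex X).V, v ∈ (thetaIndex X).Vbad → Set ((logShellsDH X logv).StarPacket v)) :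
    ¬ Summit.ABC.IUTFork.Cor312Vol.PinnedRegions (latticeSituationReal X hlog stripAutDH (ismDH logv) refl_mem_stripAutDH
        (refl_mem_ismDH logv) M archPk archSub Ψ act Mmod region col)
      (honestSetting X hlog stripAutDH (ismDH logv) refl_mem_stripAutDH (refl_mem_ismDH logv) M archPk archSub Ψ act Mmod
        region col n p) ρ qK :=
  not_pinnedRegions_honestSetting_DH_of_five_le X hlog M archPk archSub Ψ act Mmod region col n p pp
    (Nat.Prime.five_le_of_ne_two_of_ne_three pp.2 (fun h => by rw [h] at hp2; exact lt_irrefl _ hp2)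
      (fun h => by rw [h] at he; omega)) v₀ hv₀ he2 ρ qK

/-- **Packaged, ramified form**: over `F` with a ramified place `v₀ ∣ p₀`, `p₀ ≥ 5`, the antecedent of every «(hρ)-pins ⟹ …» theorem at
`honestSetting` over the Dupuy–Hilado binders is EMPTY (`¬ ∃ ρ qK, PinnedRegions …`). [claim: Mochizuki2012, status: disputed] -/
theorem not_exists_pinnedRegions_honestSetting_DH_of_five_le (pp : Nat.Primes) (hp5 : 5 ≤ (pp : ℕ)) (v₀ : HeightOneSpectrum (𝓞 F))
    (hv₀ : (thetaIndex X).over (.inr v₀) = .inr pp) (he2 : 2 ≤ v₀.asIdeal.ramificationIdx ℤ) :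
    ¬ ∃ (ρ : (∀ v : (thetaIndex X).V, v ∈ (thetaIndex X).Vbad → Set ((logShellsDH X logv).StarPacket v)) →
          ∀ (j : (thetaIndex X).Label) (vQ : (thetaIndex X).VQ), Set ((logShellsDH X logv).Packet j vQ))
        (qK : ∀ v : (thetaIndex X).V, v ∈ (thetaIndex X).Vbad → Set ((logShellsDH X logv).StarPacket v)),
      Summit.ABC.IUTFork.Cor312Vol.PinnedRegions (latticeSituationReal X hlog stripAutDH (ismDH logv) refl_mem_stripAutDH
        (refl_mem_ismDH logv) M archPk archSub Ψ act Mmod region col)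
      (honestSetting X hlog stripAutDH (ismDH logv) refl_mem_stripAutDH (refl_mem_ismDH logv) M archPk archSub Ψ act Mmod
        region col n p) ρ qK :=
  fun ⟨ρ, qK, h⟩ => not_pinnedRegions_honestSetting_DH_of_five_le X hlog M archPk archSub Ψ act Mmod region col n p pp hp5 v₀ hv₀ he2 ρ qK h

/-- **`not_pinnedRegions_honestSetting_DH_cyclotomic` — a place-free KERNEL WITNESS of (a′)'s field hypothesis**: for every number
field `F` with `IsCyclotomicExtension {p₀} ℚ F`, `p₀ ≥ 5` (the cyclotomic field `ℚ(ζ_{p₀})`), and EVERY pilot datum, logarithm family,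
auxiliary data, column family, column, box prime, `ρ`, `qK`: `¬ PinnedRegions` at `honestSetting` over (`stripAutDH`, `ismDH logv`) — NO
place hypothesis left. Ingredients BY NAME: a place `v₀ ∣ p₀` (`CyclotomicBoundary.exists_place_over`), `e(v₀|p₀) = p₀ − 1 ≥ 2` (Mathlib's
`IsCyclotomicExtension.Rat.ramificationIdx_eq_of_prime` via `CyclotomicBoundary.ramificationIdx_eq_of_cyclotomic_prime`, abc-iut TEAM R),
`over (.inr v₀) = .inr p₀` by `rfl` through `residueChar_eq_of_natCast_mem`. (The tame form `e ≤ p₀ − 2` of p445387 does not cover this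
field: `e = p₀ − 1`.) [claim: Mochizuki2012, status: disputed] [cite: Washington1997, Lemma 1.4] -/
theorem not_pinnedRegions_honestSetting_DH_cyclotomic {p₀ : ℕ} [hp₀ : Fact p₀.Prime] [IsCyclotomicExtension {p₀} ℚ F]
    (hp5 : 5 ≤ p₀)
    (ρ : (∀ v : (thetaIndex X).V, v ∈ (thetaIndex X).Vbad → Set ((logShellsDH X logv).StarPacket v)) →
      ∀ (j : (thetaIndex X).Label) (vQ : (thetaIndex X).VQ), Set ((logShellsDH X logv).Packet j vQ))
    (qK : ∀ v : (thetaIndex X).V, v ∈ (thetaIndex X).Vbad → Set ((logShellsDH X logv).StarPacket v)) :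
    ¬ Summit.ABC.IUTFork.Cor312Vol.PinnedRegions (latticeSituationReal X hlog stripAutDH (ismDH logv) refl_mem_stripAutDH
        (refl_mem_ismDH logv) M archPk archSub Ψ act Mmod region col)
      (honestSetting X hlog stripAutDH (ismDH logv) refl_mem_stripAutDH (refl_mem_ismDH logv) M archPk archSub Ψ act Mmod
        region col n p) ρ qK := by
  obtain ⟨v₀, hv⟩ := CyclotomicBoundary.exists_place_over F (p := p₀)
  refine not_pinnedRegions_honestSetting_DH_of_five_le X hlog M archPk archSub Ψ act Mmod region col n p
    ⟨p₀, hp₀.out⟩ hp5 v₀ ?_ ?_ ρ qK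
  · show (Sum.inr ⟨residueChar F v₀, residueChar_prime F v₀⟩ : RatPlace) = Sum.inr ⟨p₀, hp₀.out⟩
    exact congrArg Sum.inr (Subtype.ext (residueChar_eq_of_natCast_mem p₀ hv))
  · rw [CyclotomicBoundary.ramificationIdx_eq_of_cyclotomic_prime v₀ hv]; omega

end Summit.ABC.IUTFork.Joshi.RamifiedPins

end
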